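import Literature.NumberTheory.LFunctions.RudnickSarnakThm41Proofs
import Literature.NumberTheory.LFunctions.RudnickSarnakPairLevel
import HarnessLib

/-!
# rh.S32 reduced: `rudnick_sarnak` follows from Rudnick–Sarnak's Theorem 3.2 alone

Trunk T-ANT (`NumberTheory/LFunctions`), family RH. Companion ("Proofs") file of
`Literature/NumberTheory/LFunctions/RHConditionalFacts.lean` for its **rh.S32** named fact
`Literature.NumberTheory.LFunctions.rudnick_sarnak` (Z. Rudnick, P. Sarnak, *Zeros of principal
`L`-functions and random matrix theory*, Duke Math. J. **81** (1996), 269–322, Theorem 1.2 for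
`ζ`, `m = 1`: under RH the `n`-level correlations of the zeros of `ζ`, for test functions with
`supp f̂ ⊆ {∑ |ξ_j| < 2}`, are the GUE ones).

Rudnick–Sarnak's proof has two halves: **Theorem 3.2** (§3: the unrestricted correlation sums
`C_n(f_Φ, T)/N(T) → ∫ Φ C_O` under RH, by the `n`-fold explicit formula) and **§4** (the
combinatorial sieving, Lemma 4.1 / (4.9) / (4.14)–(4.16), and Theorem 4.1 = Props. 4.1–4.3 with
Spitzer's formula: the sieved limit is the GUE determinant). The §4 half is now a theorem of the
tree:

* `rudnick_sarnak_sieving_of_thm41` (`RudnickSarnakThm41.lean`) and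
  `rudnick_sarnak_thm41_holds` (`RudnickSarnakThm41Proofs.lean`, on
  `RudnickSarnak{Cycles,Spread,Determinant,Strata,Cube,CubeDensity,Hyperplane,Fibre,Unique,
  Refine,Merge,Glue,Pairing,PairingDensity}.lean` and `Combinatorics/Enumerative/SpitzerIdentity`),
* the final Fourier-inversion/pull-back glue `rudnick_sarnak_of_sieving`
  (`RudnickSarnakProofs.lean`) and `rudnick_sarnak_of_thm41` (`RudnickSarnakThm41.lean`),

so that the named fact `rudnick_sarnak` is reduced to the single remaining named fact
`rudnick_sarnak_unrestricted` (RS Theorem 3.2 for `ζ`): `rudnick_sarnak_of_unrestricted`.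

The reduction is *level-local*: the sieving at level `n = k + 1` only invokes Theorem 3.2 at the
levels `ν(Q) ≤ n` of the set partitions `Q` of `{1, …, n}` ((4.5), Lemma 4.1), so the conclusion
of Theorem 1.2 at level `n` follows from `RSUnrestrictedLimits` at the levels `≤ n` alone
(`RudnickSarnak.tendsto_levelCorrelationSum_div_of_unrestricted_le`; RH enters only through that
hypothesis). Since the tree proves Theorem 3.2 for `ζ` at the levels `n ≤ 2`
(`rsUnrestrictedLimits_of_le_one`, `RudnickSarnakPairLevel.lean`, from Montgomery's theorem
`montgomery_pair_correlation_restricted_holds`), the **level-two case of `rudnick_sarnak` is a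
theorem**: `rudnick_sarnak_two` — under RH, for every Rudnick–Sarnak test function `f` on `ℝ²`
with `supp f̂ ⊆ {|ξ_1| + |ξ_2| < 2}`, `R_2(B_N, f) → ∫ f(x) W_2(x) δ(x̄) dx` as `N → ∞` (RS Thm 1.2
at `n = 2`, which "coincides with the result of Montgomery", RS p. 273, Remark).

## References

* Z. Rudnick, P. Sarnak, Duke Math. J. 81 (1996), 269–322: Thm 1.2 and the Remark following it
  (p. 273), Thm 3.2, §4 (Lemma 4.1, (4.5), (4.9), (4.13)–(4.16), Thm 4.1, Props 4.1–4.3).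
* H. L. Montgomery, *The pair correlation of zeros of the zeta function*, Proc. Sympos. Pure
  Math. 24 (1973), 181–193: Theorem.
-/

namespace Literature.NumberTheory.LFunctions

/-- **`rudnick_sarnak` from Theorem 3.2 alone.** Rudnick–Sarnak's Theorem 1.2 for `ζ`
(`rudnick_sarnak`, rh.S32) follows from the named fact `rudnick_sarnak_unrestricted`
(RS Theorem 3.2: the unrestricted `n`-level sums under RH), the §4 sieving and Theorem 4.1 being
proved in the tree (`rudnick_sarnak_of_thm41`, `rudnick_sarnak_thm41_holds`).
[cite: RudnickSarnak1996, Thm 1.2 from Thm 3.2 and §4 (Thm 4.1)] -/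
theorem rudnick_sarnak_of_unrestricted (h : rudnick_sarnak_unrestricted) : rudnick_sarnak :=
  rudnick_sarnak_of_thm41 h rudnick_sarnak_thm41_holds


/-! ## The level-local reduction and the level-two case -/

namespace RudnickSarnak

open Filter Topology Finset

/-- **Theorem 1.2 for `ζ` at level `n = k + 1` from Theorem 3.2 at the levels `≤ n`.** For a
Rudnick–Sarnak test function `f` at level `n = k + 1 ≥ 2` with `supp f̂ ⊆ {∑ |ξ_j| < 2}`, if the
unrestricted sums satisfy `C_{n'}(f_Ψ, T)/N(T) → ∫ Ψ C_O` for every admissible `Ψ` at every level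
`n' = k' + 1 ≤ n` (the conclusion of RS Theorem 3.2 at those levels), then
`R_n(B_N, f) → ∫ f W_n δ(x̄) = rsLimit k f` as `N → ∞`. This is the proof of
`rudnick_sarnak_of_unrestricted` read level by level: `f = f_Φ` with `Φ` admissible
(`exists_rsPhiTest_eq`); `R_n(f_Φ, T) = ∑_Q μ(O, Q) C_{ν(Q)}(ι_Q^* f_Φ, T)/N(T)` over the set
partitions `Q` of `Fin (k + 1)` (`levelCorrelationSum_eq_sum_partitionMoebius`, (4.5)–(4.9)),
where `ν(Q) = #Q.parts ≤ k + 1` (`Finpartition.card_parts_le_card`); each `ι_Q^* f_Φ` is an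
`f_{Φ'_Q}` with `Φ'_Q` admissible at level `ν(Q) − 1 ≤ k` (`exists_rsPhiTest_comp_surjective`,
(4.14)); the hypothesis gives the limit of each term, Theorem 4.1 (`rudnick_sarnak_thm41_holds`)
identifies the sum of the limits with `rsLimit k f_Φ`, and the passage from `N = N(T)` to all `N`
is `IsRSTestFunction.tendsto_levelCorrelationSum_div`. RH is not used (it is only needed to
establish the hypothesis). [cite: RudnickSarnak1996, Thm 1.2 from Thm 3.2, §4 (4.5), (4.9), (4.14)–(4.16), Thm 4.1] -/
theorem tendsto_levelCorrelationSum_div_of_unrestricted_le {k : ℕ} (hk : 1 ≤ k)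
    (hU : ∀ {k' : ℕ}, k' ≤ k → ∀ {Ψ : (Fin (k' + 1) → ℝ) → ℂ}, IsRSAdmissiblePhi k' Ψ →
      Tendsto (fun T : ℝ ↦ unrestrictedLevelSum (k' + 1) (rsPhiTest Ψ) (zetaZeroCount T) /
        zetaZeroCount T) atTop (𝓝 (rsPairingFunctional (k' + 1) Ψ)))
    {f : (Fin (k + 1) → ℝ) → ℂ} (hf : IsRSTestFunction k f) (hsupp : HasRSFourierSupport k f) :
    Tendsto (fun N : ℕ ↦ levelCorrelationSum (k + 1) f N / N) atTop (𝓝 (rsLimit k f)) := by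
  -- `f = f_Φ` with `Φ` admissible
  obtain ⟨Φ, hΦ, rfl⟩ := exists_rsPhiTest_eq hf hsupp
  refine hf.tendsto_levelCorrelationSum_div ?_
  -- admissible representatives of the pulled-back test functions `ι_Q^* f_Φ`
  have hrep : ∀ Q : Finpartition (univ : Finset (Fin (k + 1))),
      ∃ Φ' : (Fin (#Q.parts - 1 + 1) → ℝ) → ℂ, IsRSAdmissiblePhi (#Q.parts - 1) Φ' ∧
        rsPhiTest Φ' = fun z ↦ rsPhiTest Φ (z ∘ blockIdxSucc Q) :=
    fun Q ↦ exists_rsPhiTest_comp_surjective hΦ hf.schwartz_slice (blockIdxSucc_surjective Q)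
  choose Φ' hΦ'adm hΦ'eq using hrep
  -- Theorem 4.1: the sieved combination of the limits is the GUE limit
  have hlimit : ∑ Q, (partitionMoebius Q : ℂ) * rsPairingFunctional (#Q.parts - 1 + 1) (Φ' Q) =
      rsLimit k (rsPhiTest Φ) :=
    rudnick_sarnak_thm41_holds hk hΦ hf Φ' hΦ'adm fun Q ↦ hΦ'eq Q
  -- the correlation function as the sieved combination of unrestricted sums of the `f_{Φ'_Q}`
  have hfun : (fun T : ℝ ↦ levelCorrelationSum (k + 1) (rsPhiTest Φ) (zetaZeroCount T) /
      zetaZeroCount T) = fun T ↦ ∑ Q, (partitionMoebius Q : ℂ) *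
        (unrestrictedLevelSum (#Q.parts - 1 + 1) (rsPhiTest (Φ' Q)) (zetaZeroCount T) /
          zetaZeroCount T) := by
    funext T
    rw [levelCorrelationSum_eq_sum_partitionMoebius, Finset.sum_div]
    refine Finset.sum_congr rfl fun Q _ ↦ ?_
    rw [mul_div_assoc, hΦ'eq Q, unrestrictedLevelSum_comp_cast (card_parts_eq Q)]
    congr 3
  rw [hfun, ← hlimit]
  refine tendsto_finsetSum _ fun Q _ ↦ (hU ?_ (hΦ'adm Q)).const_mul _
  -- the levels involved: `ν(Q) - 1 ≤ k`
  have hQ : #Q.parts ≤ k + 1 := by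
    simpa using Finpartition.card_parts_le_card Q
  omega

end RudnickSarnak

open Filter Topology in
/-- **Rudnick–Sarnak's Theorem 1.2 for `ζ` at level `n = 2`, proved** (the case `k = 1` of the
named fact `rudnick_sarnak`, rh.S32): under RH, for every Rudnick–Sarnak test function `f` on `ℝ²`
(TF 1–3: symmetric, diagonal-invariant, Schwartz slice) whose Fourier transform along the
hyperplane is supported in `|ξ_1| + |ξ_2| < 2`, the pair correlation sums of the normalised
ordinates `γ̃ = γ log γ/2π` satisfy `R_2(B_N, f) = (1/N) ∑_{i ≠ j < N} f(γ̃_i, γ̃_j) →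
∫ f(x) W_2(x) δ(x̄) dx = ∫ f(0, y) (1 − K(y)²) dy` (`rsLimit 1 f`; `W_2 = 1 − K²`,
`sineDeterminant_fin_two`) as `N → ∞`. As Rudnick–Sarnak remark (p. 273), "in the case of `ζ(s)`
and `n = 2`, Theorem 1.2 coincides with the result of Montgomery": here it is obtained from the
tree's proof of Montgomery's theorem (`montgomery_pair_correlation_restricted_holds`) through
RS Theorem 3.2 at the levels `n ≤ 2` (`rsUnrestrictedLimits_of_le_one`,
`RudnickSarnakPairLevel.lean`) and the level-local form of the §4 reduction
(`RudnickSarnak.tendsto_levelCorrelationSum_div_of_unrestricted_le`, with Theorem 4.1 proved).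
The levels `n ≥ 3` of `rudnick_sarnak` await RS Theorem 3.2 at the levels `≥ 3`
(`rudnick_sarnak_unrestricted`). [cite: RudnickSarnak1996, Thm 1.2 (n = 2) and Remark p. 273; Montgomery1973, Theorem] -/
theorem rudnick_sarnak_two (hRH : RiemannHypothesis) {f : (Fin 2 → ℝ) → ℂ}
    (hf : IsRSTestFunction 1 f) (hsupp : HasRSFourierSupport 1 f) :
    Tendsto (fun N : ℕ ↦ levelCorrelationSum 2 f N / N) atTop (𝓝 (rsLimit 1 f)) :=
  RudnickSarnak.tendsto_levelCorrelationSum_div_of_unrestricted_le le_rfl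
    (fun hk' _ hΨ ↦ rsUnrestrictedLimits_of_le_one hRH hk' hΨ) hf hsupp

end Literature.NumberTheory.LFunctions
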